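/-
Copyright: cell pub-rosobs (carver-g59). INSTRUMENT for engine 1's W(f) toy model — NOT a resolution theorem.
-/
import Literature.AlgebraicGeometry.Resolution.WeightedCentreHeavyTaylor
import Mathlib.RingTheory.MvPolynomial.WeightedHomogeneous
import Mathlib.RingTheory.MvPolynomial.Basic
import Mathlib.Data.ZMod.Basic
import Mathlib.Algebra.Field.ZMod
import Mathlib.Tactic.LinearCombination
import Mathlib.Tactic.Linarith
import Mathlib.Tactic.NormNum
import HarnessLib

/-!
# Truncation below a weight commutes with graded substitutions (REMARK S (1), CARVER T70 (a))

Instrument — NOT a resolution theorem, NOT a statement about the invariant of [AbramovichTemkinWlodarczyk2024], NOT summit progress;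
AI review weaker than expert review.  Engine 1's TRUNCATION LEMMA (THEOREM-LT-eng1-g38 §14 REMARK S (1); CARVER-NOTES-eng1-g38 T70 (a))
for the cell's `W(f)` TOY MODEL, typed as plain commutative algebra: `truncate_C (g∘Π) = (truncate_C g)∘(Π.truncate_C)`.

Dictionary.  "`truncate C` kills every monomial containing a variable of weight `< w_C`" is the tree's `killLight H` of
`WeightedCentreHeavyTaylor` with the heavy predicate `H i := c ≤ w i` (`c = w_C`): killing the light VARIABLES kills exactly the monomials
containing one (`killLight_monomial`).  A substitution `Π : X_i ↦ π_i` is `MvPolynomial.aeval π`; "`Π.truncate C`" is `X_i ↦ killLight H (π i)`.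
* `killLight_aeval` — the lemma in its natural generality: if `Π` maps every light variable into the ideal of the light variables
  (`killLight H (π i) = 0` for light `i`), then `killLight H (Π g) = (Π.truncate) (killLight H g)`.
* `killLight_eq_zero_of_isWeightedHomogeneous` — why graded substitutions qualify: a weighted-homogeneous polynomial of weight `d` with
  `0 ≠ d < c` (weights in `ℚ`, `0 < c`) has no heavy monomial, so it is killed.
* `killLight_aeval_of_graded` — **REMARK S (1)**: for `π_i` weighted homogeneous of weight `w_i` (a graded substitution "without constants"
  is automatic: weight `w_i ≠ 0`), `killLight_{c ≤ w} (Π g) = Π.truncate (killLight_{c ≤ w} g)`; `IsWeightedHomogeneous.killLight` — the truncated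
  substitution is again graded.
* `IsPinnedIn w l F := l ∈ vars (killLight_{w_l ≤ w} F)` — T9 §1 PIN: "some monomial of `F` contains `X_l` and no variable of weight `< w_l`";
  `isPinnedIn_aeval_iff` — "(P) for the class of `l` in `g∘Π`" is BOTTOM-pinning of the truncated face `(killLight g)∘(Π.truncate)`.
* SHEAR WITNESS (CARVER T70 (b)(i); engine 1's b11check38 / C446): over `𝔽₅`, `g = V₁V₂² + 2V₂²(W₁² + W₂²) + 2V₂W₁⁴ + 2W₁⁶` and the shear
  `V₁ ↦ V₁ + 3W₂²` give `g ↦ V₁V₂² + 2V₂²W₁² + 2V₂W₁⁴ + 2W₁⁶`, free of `W₂` (`shear446_g446`, `notMem_vars_shear446_g446`), hence `W₂` unpinned for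
  every weighting (`not_isPinnedIn_shear446_g446`).
* AUTOMORPHISMS (v2; REMARK S (1) "… a graded automorphism of `(N_{≥C}, w)`; and every graded automorphism of the truncation arises so.
  Hence (P) for the class C ⇔ BOTTOM-(P) for the truncated face"): endomorphisms are `S`-algebra maps `Φ` with `IsGraded w Φ` (every `Φ X_i`
  weighted homogeneous of weight `w_i`), `truncHom w c Φ = Π_{≥C}`; `killLight_apply_of_isGraded` (REMARK S (1) for `Φ`);
  `truncHom_truncHom_killLight` (`Π ∘ Π' = id` ⇒ `Π_{≥C} ∘ Π'_{≥C} = id` on the truncated ring: `Π_{≥C}` IS an automorphism of the truncation);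
  `liftHom` (extension by the identity on the light variables) with `isGradedAutPair_liftHom` and `liftHom_apply_killLight` (every automorphism
  pair of the truncation is the truncation of a graded automorphism pair of the whole ring); `SlotPinned w l g` ((P) for the slot `l`:
  `X_l` pinned in `Φ g` for every graded automorphism pair), `BottomPinned w l g` (BOTTOM-(P): `X_l` occurs in `Φ (truncate g)` for every graded
  automorphism pair whose `Φ` keeps the heavy variables in the truncated ring), and **`slotPinned_iff_bottomPinned`** (the "Hence", for
  `0 < w_l` and no weight-`0` slot); `not_slotPinned_g446` (the C446 shear with its inverse `V₁ ↦ V₁ + 2W₂²` is a graded automorphism pair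
  whenever `w(V₁) = 2w(W₂)`, so `W₂` is not (P)-pinned in `g446`).
* BLOCK-DIAGONAL HALF (v3; CARVER T70 (b)(ii), by proof instead of the engine's 900-class enumeration): `mem_vars_blockDiag_g446` — for EVERY
  pair of invertible `2×2` matrices `A, B` over `𝔽₅` acting block-diagonally (`V ↦ AV`, `W ↦ BW`), `W₂ ∈ vars (g446∘(A ⊕ B))` (evaluate at
  `(x, y, 0, t)`: `t`-independence would force the second column of `B` to vanish).  With `not_slotPinned_g446` this is REMARK S (4)'s phenomenon:
  the decoupled block-diagonal criterion holds while (P) fails, so that criterion is valid only in shear-normal form.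
* UNPINNABLE SLOTS (v4; CARVER-NOTES eng1-g39 T71, FINDING F2): `Unpinnable w l μ` (no exponent vector of weight `μ` contains `X_l` with
  only variables of weight `≥ w_l`); **`not_slotPinned_of_unpinnable`** — then NO weighted-homogeneous `g` of weight `μ` satisfies (P) at `l`
  (take `Π = id`; indeed `X_l` is pinned in no graded image `Φ g`, `not_isPinnedIn_apply_of_unpinnable`, via
  `IsGraded.isWeightedHomogeneous_apply`); `unpinnable_of_congruence` (the arithmetic: `D·w_l = a` coprime to `m`, heavier weights and `D·μ`
  multiples of `m`, `μ < m·w_l`) and the instances `unpinnable_three_eighths` (`(p; ½, ⅜, ¼)`, the `⅜` slot) and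
  `unpinnable_seven_fortyEighths` (`(7; ½, ⅓, ⅙, 7/48)`, `(7; ½, ⅓, ⅙, ⅙, 7/48)`, the `7/48` slot): four of the g38 brute-force systems were
  vacuous.
NOT here: `(P)` for a whole SYSTEM (all faces, all classes — the cell's modelling notion; `SlotPinned` is the one-slot, one-face clause);
automorphisms of the truncation are represented as heavy-preserving graded automorphism pairs of the whole ring (by `liftHom` nothing is
lost).

References: weighted blow-ups / weighted gradings [cite: AbramovichTemkinWlodarczyk2024, §5.1 (p. 1575)]; polynomial substitutions
[cite: Lang2002, Ch. IV §1]; the statements are engine 1's, the formalisation ours.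
-/

open MvPolynomial

namespace Literature.AlgebraicGeometry.Resolution.WeightedBlowup

namespace Truncation

variable {S : Type*} [CommRing S] {ι : Type*}

section General

variable (H : ι → Prop) [DecidablePred H]

/-- `killLight` is idempotent (bookkeeping). [cite: AbramovichTemkinWlodarczyk2024, §5.1 (p. 1575)] -/
theorem killLight_killLight (F : MvPolynomial ι S) : killLight H (killLight H F) = killLight H F := by
  have key : (killLight (S := S) H).comp (killLight H) = killLight H := by
    refine MvPolynomial.algHom_ext fun i => ?_
    rw [AlgHom.comp_apply, killLight_X, heavyX]
    split_ifs with hi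
    · rw [killLight_X, heavyX, if_pos hi]
    · rw [map_zero]
  exact congrArg (fun φ : MvPolynomial ι S →ₐ[S] MvPolynomial ι S => φ F) key

/-- **Truncation commutes with substitutions preserving the light ideal** (engine 1, REMARK S (1), general form; derived here): if
`killLight H (π i) = 0` for every light `i` (every monomial of `π i` contains a light variable), then
`killLight H (g∘Π) = (killLight H g)∘(Π.truncate)` with `Π.truncate : X_i ↦ killLight H (π i)`. [cite: Lang2002, Ch. IV §1] -/
theorem killLight_aeval (π : ι → MvPolynomial ι S) (hπ : ∀ i, ¬ H i → killLight H (π i) = 0) (g : MvPolynomial ι S) :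
    killLight H (aeval π g) = aeval (fun i => killLight H (π i)) (killLight H g) := by
  have key : (killLight (S := S) H).comp (aeval π) = (aeval fun i => killLight H (π i)).comp (killLight H) := by
    refine MvPolynomial.algHom_ext fun i => ?_
    rw [AlgHom.comp_apply, AlgHom.comp_apply, aeval_X, killLight_X, heavyX]
    split_ifs with hi
    · rw [aeval_X]
    · rw [map_zero, hπ i hi]
  exact congrArg (fun φ : MvPolynomial ι S →ₐ[S] MvPolynomial ι S => φ g) key

/-- `killLight` only deletes monomials, so it preserves weighted homogeneity (bookkeeping). [cite: AbramovichTemkinWlodarczyk2024, §5.1 (p. 1575)] -/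
theorem _root_.MvPolynomial.IsWeightedHomogeneous.killLight {M : Type*} [AddCommMonoid M] {w : ι → M} {P : MvPolynomial ι S} {d : M}
    (hP : IsWeightedHomogeneous w P d) : IsWeightedHomogeneous w (killLight H P) d := by
  intro t ht
  rw [coeff_killLight] at ht
  split_ifs at ht with hHt
  · exact hP ht
  · exact absurd rfl ht

end General

section Weighted

variable (w : ι → ℚ) (c : ℚ)

/-- **Graded pieces below the threshold are killed** (derived here): with weights `w : ι → ℚ`, threshold `0 < c` and heavy predicate
`c ≤ w i`, a weighted-homogeneous `P` of weight `d` with `d ≠ 0`, `d < c` satisfies `killLight P = 0` — a heavy non-constant monomial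
weighs at least `c`. [cite: AbramovichTemkinWlodarczyk2024, §5.1 (p. 1575)] -/
theorem killLight_eq_zero_of_isWeightedHomogeneous (hc : 0 < c) {P : MvPolynomial ι S} {d : ℚ} (hP : IsWeightedHomogeneous w P d)
    (hd0 : d ≠ 0) (hdc : d < c) : killLight (fun i => c ≤ w i) P = 0 := by
  have hsupp : ∀ κ ∈ P.support, κ ≠ 0 → ¬ IsHeavy (fun i => c ≤ w i) κ := by
    intro κ hκ hκ0 hH
    have hwt : Finsupp.weight w κ = d := hP (mem_support_iff.mp hκ)
    obtain ⟨i₀, hi₀⟩ : ∃ i₀, i₀ ∈ κ.support := by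
      by_contra h
      push Not at h
      exact hκ0 (Finsupp.support_eq_empty.mp (Finset.eq_empty_of_forall_notMem h))
    have hle : c ≤ Finsupp.weight w κ := by
      rw [Finsupp.weight_apply, Finsupp.sum]
      have h1 : c ≤ κ i₀ • w i₀ := by
        have hk : (1 : ℚ) ≤ κ i₀ := by exact_mod_cast Nat.one_le_iff_ne_zero.mpr (Finsupp.mem_support_iff.mp hi₀)
        have hwi : c ≤ w i₀ := hH i₀ hi₀
        rw [nsmul_eq_mul]
        nlinarith
      refine h1.trans (Finset.single_le_sum (f := fun i => κ i • w i) (fun i hi => ?_) hi₀)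
      rw [nsmul_eq_mul]
      have hwi : c ≤ w i := hH i hi
      have : (0 : ℚ) ≤ κ i := by positivity
      nlinarith
    rw [hwt] at hle
    exact absurd hdc (not_lt.mpr hle)
  rw [killLight_eq_C_coeff_zero _ P hsupp]
  have h0 : coeff 0 P = 0 := by
    by_contra hne
    have := hP hne
    rw [map_zero] at this
    exact hd0 this.symm
  rw [h0, C_0]

/-- **REMARK S (1) — truncation commutes with graded substitutions** (engine 1, THEOREM-LT §14; CARVER T70 (a); derived here): for a
substitution `Π : X_i ↦ π_i` with `π_i` weighted homogeneous of weight `w_i` (no constants: `w_i ≠ 0` below the threshold) and a threshold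
`0 < c`, `truncate_c (g∘Π) = (truncate_c g)∘(Π.truncate_c)`. [cite: AbramovichTemkinWlodarczyk2024, §5.1 (p. 1575)] -/
theorem killLight_aeval_of_graded (hc : 0 < c) (hw : ∀ i, w i < c → w i ≠ 0) (π : ι → MvPolynomial ι S)
    (hπ : ∀ i, IsWeightedHomogeneous w (π i) (w i)) (g : MvPolynomial ι S) :
    killLight (fun i => c ≤ w i) (aeval π g)
      = aeval (fun i => killLight (fun i => c ≤ w i) (π i)) (killLight (fun i => c ≤ w i) g) :=
  killLight_aeval _ π (fun i hi => killLight_eq_zero_of_isWeightedHomogeneous w c hc (hπ i) (hw i (lt_of_not_ge hi)) (lt_of_not_ge hi)) g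

/-- The truncated substitution is again graded (bookkeeping). [cite: AbramovichTemkinWlodarczyk2024, §5.1 (p. 1575)] -/
theorem isWeightedHomogeneous_truncate (π : ι → MvPolynomial ι S) (hπ : ∀ i, IsWeightedHomogeneous w (π i) (w i)) (i : ι) :
    IsWeightedHomogeneous w (killLight (fun j => c ≤ w j) (π i)) (w i) :=
  (hπ i).killLight _

/-- **PIN** (the cell's T9 §1, as a formal predicate; ours): slot `l` is pinned in `F` when some monomial of `F` contains `X_l` and no
variable of weight `< w_l`, i.e. `X_l` occurs in the truncation of `F` at the threshold `w_l`. [cite: AbramovichTemkinWlodarczyk2024, §5.1 (p. 1575)] -/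
def IsPinnedIn (l : ι) (F : MvPolynomial ι S) : Prop := l ∈ (killLight (fun j => w l ≤ w j) F).vars

/-- **"(P) for a class = BOTTOM-(P) of the truncated face"** (engine 1, REMARK S (1); derived here): for a graded substitution `Π` and a slot
`l` of positive weight (weights below `w_l` non-zero), `l` is pinned in `g∘Π` iff `X_l` occurs in `(truncate_{w_l} g)∘(Π.truncate_{w_l})`.
[cite: AbramovichTemkinWlodarczyk2024, §5.1 (p. 1575)] -/
theorem isPinnedIn_aeval_iff {l : ι} (hl : 0 < w l) (hw : ∀ i, w i < w l → w i ≠ 0) (π : ι → MvPolynomial ι S)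
    (hπ : ∀ i, IsWeightedHomogeneous w (π i) (w i)) (g : MvPolynomial ι S) :
    IsPinnedIn w l (aeval π g)
      ↔ l ∈ (aeval (fun i => killLight (fun j => w l ≤ w j) (π i)) (killLight (fun j => w l ≤ w j) g)).vars := by
  rw [IsPinnedIn, killLight_aeval_of_graded w (w l) hl hw π hπ g]

end Weighted

section Vars

variable (H : ι → Prop) [DecidablePred H]

/-- `killLight` only deletes monomials: its variables are among those of the argument (bookkeeping).
[cite: AbramovichTemkinWlodarczyk2024, §5.1 (p. 1575)] -/
theorem vars_killLight_subset [DecidableEq ι] (F : MvPolynomial ι S) : (killLight H F).vars ⊆ F.vars := by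
  intro i hi
  rw [mem_vars_iff_mem_support] at hi ⊢
  obtain ⟨d, hd, hid⟩ := hi
  refine ⟨d, ?_, hid⟩
  rw [mem_support_iff, coeff_killLight] at hd
  rw [mem_support_iff]
  split_ifs at hd with h
  · exact hd
  · exact absurd rfl hd

end Vars

/-! ## The shear witness C446 (CARVER T70 (b)(i)): a non-block-diagonal graded change unpins `W₂` -/

section ShearWitness

/-- Engine 1's witness face over `𝔽₅` (b11check38 / C446): `V₁ = X 0`, `V₂ = X 1`, `W₁ = X 2`, `W₂ = X 3`,
`g = V₁V₂² + 2V₂²(W₁² + W₂²) + 2V₂W₁⁴ + 2W₁⁶` (data, the engine's). [cite: AbramovichTemkinWlodarczyk2024, §5.1 (p. 1575)] -/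
noncomputable def g446 : MvPolynomial (Fin 4) (ZMod 5) :=
  X 0 * X 1 ^ 2 + 2 * X 1 ^ 2 * (X 2 ^ 2 + X 3 ^ 2) + 2 * X 1 * X 2 ^ 4 + 2 * X 2 ^ 6

/-- The shear `V₁ ↦ V₁ + 3W₂²`, identity on the other variables (data, the engine's). [cite: Lang2002, Ch. IV §1] -/
noncomputable def shear446 : MvPolynomial (Fin 4) (ZMod 5) →ₐ[ZMod 5] MvPolynomial (Fin 4) (ZMod 5) :=
  aeval (Function.update X 0 (X 0 + 3 * X 3 ^ 2))

/-- **T70 (b)(i), the identity**: `g∘shear = V₁V₂² + 2V₂²W₁² + 2V₂W₁⁴ + 2W₁⁶` in characteristic `5` (the `W₂`-terms `3V₂²W₂² + 2V₂²W₂²`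
cancel). [cite: Lang2002, Ch. IV §1] -/
theorem shear446_g446 : shear446 g446 = X 0 * X 1 ^ 2 + 2 * X 1 ^ 2 * X 2 ^ 2 + 2 * X 1 * X 2 ^ 4 + 2 * X 2 ^ 6 := by
  have h5 : (5 : MvPolynomial (Fin 4) (ZMod 5)) = 0 := by
    have h := CharP.cast_eq_zero (MvPolynomial (Fin 4) (ZMod 5)) 5
    simpa using h
  have h1 : (1 : Fin 4) ≠ 0 := by decide
  have h2 : (2 : Fin 4) ≠ 0 := by decide
  have h3 : (3 : Fin 4) ≠ 0 := by decide
  simp only [shear446, g446, map_add, map_mul, map_pow, map_ofNat, aeval_X, Function.update_self,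
    Function.update_of_ne h1, Function.update_of_ne h2, Function.update_of_ne h3]
  linear_combination (X 1 ^ 2 * X 3 ^ 2) * h5

/-- **T70 (b)(i)**: after the shear no monomial of `g` contains `W₂` (`3 ∉ vars`). [cite: Lang2002, Ch. IV §1] -/
theorem notMem_vars_shear446_g446 : (3 : Fin 4) ∉ (shear446 g446).vars := by
  rw [shear446_g446]
  -- the right-hand side comes from `Fin 3` along `Fin.castSucc`, whose image misses `3 = Fin.last 3`
  set P₃ : MvPolynomial (Fin 3) (ZMod 5) := X 0 * X 1 ^ 2 + 2 * X 1 ^ 2 * X 2 ^ 2 + 2 * X 1 * X 2 ^ 4 + 2 * X 2 ^ 6 with hP₃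
  have e0 : Fin.castSucc (0 : Fin 3) = (0 : Fin 4) := by decide
  have e1 : Fin.castSucc (1 : Fin 3) = (1 : Fin 4) := by decide
  have e2 : Fin.castSucc (2 : Fin 3) = (2 : Fin 4) := by decide
  have hre : rename Fin.castSucc P₃ = (X 0 * X 1 ^ 2 + 2 * X 1 ^ 2 * X 2 ^ 2 + 2 * X 1 * X 2 ^ 4 + 2 * X 2 ^ 6 :
      MvPolynomial (Fin 4) (ZMod 5)) := by
    simp only [hP₃, map_add, map_mul, map_pow, map_ofNat, rename_X, e0, e1, e2]
  rw [← hre]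
  intro h
  obtain ⟨i, -, hi⟩ := Finset.mem_image.mp (vars_rename _ _ h)
  exact absurd hi (Fin.castSucc_lt_last i).ne

/-- **T70 (b)(i), pin reading**: for every weighting `w`, `W₂` is NOT pinned in `g∘shear` — a non-block-diagonal graded change unpins the
multi-slot heavy class, so a `(P)`-criterion must not be stated block-diagonally (engine 1, THEOREM-LT §14 REMARK S).
[cite: AbramovichTemkinWlodarczyk2024, §5.1 (p. 1575)] -/
theorem not_isPinnedIn_shear446_g446 (w : Fin 4 → ℚ) : ¬ IsPinnedIn w 3 (shear446 g446) := fun h =>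
  notMem_vars_shear446_g446 (vars_killLight_subset _ _ h)

end ShearWitness


/-! ## Automorphisms: `Π_{≥C}` is an automorphism of the truncation, and every one arises so (REMARK S (1), "Hence") -/

section Automorphism

variable (H : ι → Prop) [DecidablePred H]

/-- Two `S`-algebra endomorphisms agreeing on the heavy variables agree on every truncated polynomial (bookkeeping for REMARK S (1)).
[cite: AbramovichTemkinWlodarczyk2024, §5.1 (p. 1575)] -/
theorem apply_killLight_congr {Φ₁ Φ₂ : MvPolynomial ι S →ₐ[S] MvPolynomial ι S} (h : ∀ i, H i → Φ₁ (X i) = Φ₂ (X i))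
    (g : MvPolynomial ι S) : Φ₁ (killLight H g) = Φ₂ (killLight H g) := by
  have key : Φ₁.comp (killLight H) = Φ₂.comp (killLight H) := by
    refine algHom_ext fun i => ?_
    simp only [AlgHom.comp_apply, killLight_X, heavyX]
    by_cases hi : H i
    · rw [if_pos hi, h i hi]
    · rw [if_neg hi, map_zero, map_zero]
  exact DFunLike.congr_fun key g

variable (w : ι → ℚ) (c : ℚ)

/-- A GRADED substitution / endomorphism `Φ` of the weighted polynomial ring: every `Φ(X_i)` is weighted homogeneous of weight `w_i`
(engine 1's "graded automorphisms" are the invertible ones; derived here). [cite: AbramovichTemkinWlodarczyk2024, §5.1 (p. 1575)] -/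
def IsGraded (Φ : MvPolynomial ι S →ₐ[S] MvPolynomial ι S) : Prop := ∀ i, IsWeightedHomogeneous w (Φ (X i)) (w i)

/-- The TRUNCATION `Π_{≥C}` of an endomorphism `Π` at the threshold `c = w_C`: `X_i ↦ truncate_c (Π X_i)` ("`Π` followed by killing the
variables of weight `< w_C`", REMARK S (1); derived here). [cite: AbramovichTemkinWlodarczyk2024, §5.1 (p. 1575)] -/
noncomputable def truncHom (Φ : MvPolynomial ι S →ₐ[S] MvPolynomial ι S) : MvPolynomial ι S →ₐ[S] MvPolynomial ι S :=
  aeval fun i => killLight (fun j => c ≤ w j) (Φ (X i))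

/-- `Π_{≥C}` on a generator (bookkeeping). [cite: AbramovichTemkinWlodarczyk2024, §5.1 (p. 1575)] -/
@[simp] theorem truncHom_X (Φ : MvPolynomial ι S →ₐ[S] MvPolynomial ι S) (i : ι) :
    truncHom w c Φ (X i) = killLight (fun j => c ≤ w j) (Φ (X i)) :=
  aeval_X _ _

/-- `Π_{≥C}` takes values in the truncated ring `S[N_{≥C}]` (bookkeeping). [cite: AbramovichTemkinWlodarczyk2024, §5.1 (p. 1575)] -/
theorem killLight_truncHom_X (Φ : MvPolynomial ι S →ₐ[S] MvPolynomial ι S) (i : ι) :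
    killLight (fun j => c ≤ w j) (truncHom w c Φ (X i)) = truncHom w c Φ (X i) := by
  rw [truncHom_X, killLight_killLight]

/-- `Π_{≥C}` is graded when `Π` is (bookkeeping). [cite: AbramovichTemkinWlodarczyk2024, §5.1 (p. 1575)] -/
theorem isGraded_truncHom {Φ : MvPolynomial ι S →ₐ[S] MvPolynomial ι S} (hΦ : IsGraded w Φ) : IsGraded w (truncHom w c Φ) := by
  intro i
  rw [truncHom_X]
  exact (hΦ i).killLight _

/-- **REMARK S (1) for an endomorphism**: `truncate_c (Π g) = Π_{≥C} (truncate_c g)` for graded `Π`, `0 < c`, no weight-`0` light slot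
(derived here). [cite: AbramovichTemkinWlodarczyk2024, §5.1 (p. 1575)] -/
theorem killLight_apply_of_isGraded (hc : 0 < c) (hw : ∀ i, w i < c → w i ≠ 0) {Φ : MvPolynomial ι S →ₐ[S] MvPolynomial ι S}
    (hΦ : IsGraded w Φ) (g : MvPolynomial ι S) :
    killLight (fun i => c ≤ w i) (Φ g) = truncHom w c Φ (killLight (fun i => c ≤ w i) g) := by
  have hΦ' : (aeval fun i => Φ (X i)) = Φ := algHom_ext fun i => aeval_X _ _
  have h := killLight_aeval_of_graded w c hc hw (fun i => Φ (X i)) hΦ g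
  rw [hΦ'] at h
  exact h

/-- An endomorphism `Φ'` mapping the heavy variables into the truncated ring agrees with its own truncation `Φ'_{≥C}` on `S[N_{≥C}]` — so an
automorphism of the truncation, extended by anything graded on the light variables, has truncation itself ("every graded automorphism of
the truncation arises so"; derived here). [cite: AbramovichTemkinWlodarczyk2024, §5.1 (p. 1575)] -/
theorem truncHom_apply_killLight_of_preserves {Φ' : MvPolynomial ι S →ₐ[S] MvPolynomial ι S}
    (hΦ' : ∀ i, c ≤ w i → killLight (fun j => c ≤ w j) (Φ' (X i)) = Φ' (X i)) (g : MvPolynomial ι S) :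
    truncHom w c Φ' (killLight (fun j => c ≤ w j) g) = Φ' (killLight (fun j => c ≤ w j) g) :=
  apply_killLight_congr _ (fun i hi => by rw [truncHom_X, hΦ' i hi]) g

/-- **`Π_{≥C}` is an automorphism of the truncation** (REMARK S (1); derived here): if `Π ∘ Π' = id` with `Π`, `Π'` graded, then
`Π_{≥C} (Π'_{≥C} F) = F` for every `F` in the truncated ring `S[N_{≥C}]` (= the image of `truncate_c`).
[cite: AbramovichTemkinWlodarczyk2024, §5.1 (p. 1575)] -/
theorem truncHom_truncHom_killLight (hc : 0 < c) (hw : ∀ i, w i < c → w i ≠ 0) {Φ Φ' : MvPolynomial ι S →ₐ[S] MvPolynomial ι S}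
    (hΦ : IsGraded w Φ) (hΦ' : IsGraded w Φ') (hinv : ∀ g, Φ (Φ' g) = g) (g : MvPolynomial ι S) :
    truncHom w c Φ (truncHom w c Φ' (killLight (fun i => c ≤ w i) g)) = killLight (fun i => c ≤ w i) g := by
  rw [← killLight_apply_of_isGraded w c hc hw hΦ', ← killLight_apply_of_isGraded w c hc hw hΦ, hinv]

/-- A GRADED AUTOMORPHISM PAIR of the weighted polynomial ring: `Π`, `Π'` graded and mutually inverse (engine 1's graded automorphisms
`Π` of `(N, w)`; derived here). [cite: AbramovichTemkinWlodarczyk2024, §5.1 (p. 1575)] -/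
def IsGradedAutPair (Φ Φ' : MvPolynomial ι S →ₐ[S] MvPolynomial ι S) : Prop :=
  IsGraded w Φ ∧ IsGraded w Φ' ∧ (∀ g, Φ (Φ' g) = g) ∧ ∀ g, Φ' (Φ g) = g

omit [DecidablePred H] in
/-- The symmetric pair (bookkeeping). [cite: AbramovichTemkinWlodarczyk2024, §5.1 (p. 1575)] -/
theorem IsGradedAutPair.symm {Φ Φ' : MvPolynomial ι S →ₐ[S] MvPolynomial ι S} (h : IsGradedAutPair w Φ Φ') : IsGradedAutPair w Φ' Φ :=
  ⟨h.2.1, h.1, h.2.2.2, h.2.2.1⟩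

/-- The LIFT of a truncated substitution: `X_i ↦ truncate_c (Π X_i)` on the heavy variables, `X_i ↦ X_i` on the light ones (the
"extension by the identity" realising every automorphism of the truncation as a `Π_{≥C}`; derived here).
[cite: AbramovichTemkinWlodarczyk2024, §5.1 (p. 1575)] -/
noncomputable def liftHom (Φ : MvPolynomial ι S →ₐ[S] MvPolynomial ι S) : MvPolynomial ι S →ₐ[S] MvPolynomial ι S :=
  aeval fun i => if c ≤ w i then killLight (fun j => c ≤ w j) (Φ (X i)) else X i

/-- The lift on a heavy generator (bookkeeping). [cite: AbramovichTemkinWlodarczyk2024, §5.1 (p. 1575)] -/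
theorem liftHom_X_of_le (Φ : MvPolynomial ι S →ₐ[S] MvPolynomial ι S) {i : ι} (hi : c ≤ w i) :
    liftHom w c Φ (X i) = killLight (fun j => c ≤ w j) (Φ (X i)) := by
  rw [liftHom, aeval_X, if_pos hi]

/-- The lift on a light generator (bookkeeping). [cite: AbramovichTemkinWlodarczyk2024, §5.1 (p. 1575)] -/
theorem liftHom_X_of_lt (Φ : MvPolynomial ι S →ₐ[S] MvPolynomial ι S) {i : ι} (hi : w i < c) :
    liftHom w c Φ (X i) = X i := by
  rw [liftHom, aeval_X, if_neg (not_le.mpr hi)]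

/-- The lift agrees with `Π_{≥C}` on the truncated ring (bookkeeping). [cite: AbramovichTemkinWlodarczyk2024, §5.1 (p. 1575)] -/
theorem liftHom_apply_killLight (Φ : MvPolynomial ι S →ₐ[S] MvPolynomial ι S) (g : MvPolynomial ι S) :
    liftHom w c Φ (killLight (fun j => c ≤ w j) g) = truncHom w c Φ (killLight (fun j => c ≤ w j) g) :=
  apply_killLight_congr _ (fun i hi => by rw [liftHom_X_of_le w c Φ hi, truncHom_X]) g

/-- The lift maps the heavy variables into the truncated ring (bookkeeping). [cite: AbramovichTemkinWlodarczyk2024, §5.1 (p. 1575)] -/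
theorem killLight_liftHom_X (Φ : MvPolynomial ι S →ₐ[S] MvPolynomial ι S) {i : ι} (hi : c ≤ w i) :
    killLight (fun j => c ≤ w j) (liftHom w c Φ (X i)) = liftHom w c Φ (X i) := by
  rw [liftHom_X_of_le w c Φ hi, killLight_killLight]

/-- The lift of a graded substitution is graded (bookkeeping). [cite: AbramovichTemkinWlodarczyk2024, §5.1 (p. 1575)] -/
theorem isGraded_liftHom {Φ : MvPolynomial ι S →ₐ[S] MvPolynomial ι S} (hΦ : IsGraded w Φ) : IsGraded w (liftHom w c Φ) := by
  intro i
  by_cases hi : c ≤ w i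
  · rw [liftHom_X_of_le w c Φ hi]
    exact (hΦ i).killLight _
  · rw [liftHom_X_of_lt w c Φ (lt_of_not_ge hi)]
    exact isWeightedHomogeneous_X S w i

/-- `Π_{≥C} (truncate (Π' X_i)) = truncate X_i` for a graded inverse pair (the generator form of `truncHom_truncHom_killLight`; bookkeeping).
[cite: AbramovichTemkinWlodarczyk2024, §5.1 (p. 1575)] -/
theorem truncHom_killLight_apply_X (hc : 0 < c) (hw : ∀ i, w i < c → w i ≠ 0) {Ψ Ψ' : MvPolynomial ι S →ₐ[S] MvPolynomial ι S}
    (hΨ : IsGraded w Ψ) (hinv : ∀ g, Ψ (Ψ' g) = g) (i : ι) :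
    truncHom w c Ψ (killLight (fun j => c ≤ w j) (Ψ' (X i))) = killLight (fun j => c ≤ w j) (X i) := by
  rw [← killLight_apply_of_isGraded w c hc hw hΨ, hinv]

/-- One composite of the lifted pair is the identity (bookkeeping). [cite: AbramovichTemkinWlodarczyk2024, §5.1 (p. 1575)] -/
theorem liftHom_liftHom (hc : 0 < c) (hw : ∀ i, w i < c → w i ≠ 0) {Ψ Ψ' : MvPolynomial ι S →ₐ[S] MvPolynomial ι S}
    (hΨ : IsGraded w Ψ) (hinv : ∀ g, Ψ (Ψ' g) = g) (g : MvPolynomial ι S) :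
    liftHom w c Ψ (liftHom w c Ψ' g) = g := by
  have hcomp : (liftHom w c Ψ).comp (liftHom w c Ψ') = AlgHom.id S _ := by
    refine algHom_ext fun i => ?_
    rw [AlgHom.comp_apply, AlgHom.id_apply]
    by_cases hi : c ≤ w i
    · rw [liftHom_X_of_le w c Ψ' hi, liftHom_apply_killLight, truncHom_killLight_apply_X w c hc hw hΨ hinv, killLight_X, heavyX,
        if_pos hi]
    · rw [liftHom_X_of_lt w c Ψ' (lt_of_not_ge hi), liftHom_X_of_lt w c Ψ (lt_of_not_ge hi)]
  exact DFunLike.congr_fun hcomp g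

/-- **The lifted pair is a graded automorphism pair** (REMARK S (1): the truncation of a graded automorphism, extended by the identity on the
light variables, is a graded automorphism of the whole ring whose truncation is `Π_{≥C}`; derived here).
[cite: AbramovichTemkinWlodarczyk2024, §5.1 (p. 1575)] -/
theorem isGradedAutPair_liftHom (hc : 0 < c) (hw : ∀ i, w i < c → w i ≠ 0) {Φ Φ' : MvPolynomial ι S →ₐ[S] MvPolynomial ι S}
    (h : IsGradedAutPair w Φ Φ') : IsGradedAutPair w (liftHom w c Φ) (liftHom w c Φ') :=
  ⟨isGraded_liftHom w c h.1, isGraded_liftHom w c h.2.1, liftHom_liftHom w c hc hw h.1 h.2.2.1,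
    liftHom_liftHom w c hc hw h.2.1 h.2.2.2⟩

/-- **(P) for one slot**, formally (engine 1's pin condition T9 §1 quantified over all graded automorphisms; derived here): `X_l` is pinned in
`g∘Π` for EVERY graded automorphism pair `(Π, Π⁻¹)` of the weighted polynomial ring. [cite: AbramovichTemkinWlodarczyk2024, §5.1 (p. 1575)] -/
def SlotPinned (l : ι) (g : MvPolynomial ι S) : Prop :=
  ∀ Φ Φ' : MvPolynomial ι S →ₐ[S] MvPolynomial ι S, IsGradedAutPair w Φ Φ' → IsPinnedIn w l (Φ g)

/-- **BOTTOM-(P) for one slot of the truncated face** (REMARK S (1); derived here): for every graded automorphism pair whose first member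
maps the variables of weight `≥ w_l` into the truncated ring `S[N_{≥ w_l}]` (= an automorphism of the truncation extended gradedly to the
light variables), `X_l` OCCURS in the image of the truncated face `g_{≥C} = truncate_{w_l} g`.
[cite: AbramovichTemkinWlodarczyk2024, §5.1 (p. 1575)] -/
def BottomPinned (l : ι) (g : MvPolynomial ι S) : Prop :=
  ∀ Φ Φ' : MvPolynomial ι S →ₐ[S] MvPolynomial ι S, IsGradedAutPair w Φ Φ' →
    (∀ i, w l ≤ w i → killLight (fun j => w l ≤ w j) (Φ (X i)) = Φ (X i)) →
      l ∈ (Φ (killLight (fun j => w l ≤ w j) g)).vars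

/-- **REMARK S (1), "Hence": (P) for the class of `X_l` ⇔ BOTTOM-(P) for the truncated face** (engine 1, THEOREM-LT §14; derived here), for
positive weights with no weight-`0` slot below `w_l`. (⇒): a truncation-preserving automorphism agrees with its truncation on the truncated
ring; (⇐): apply BOTTOM-(P) to the LIFT of `(Π_{≥C}, Π'_{≥C})`, a graded automorphism pair by `isGradedAutPair_liftHom`.
[cite: AbramovichTemkinWlodarczyk2024, §5.1 (p. 1575)] -/
theorem slotPinned_iff_bottomPinned {l : ι} (hl : 0 < w l) (hw : ∀ i, w i < w l → w i ≠ 0) (g : MvPolynomial ι S) :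
    SlotPinned w l g ↔ BottomPinned w l g := by
  constructor
  · intro hP Φ Φ' hΦ hpres
    have h1 := hP Φ Φ' hΦ
    rw [IsPinnedIn, killLight_apply_of_isGraded w (w l) hl hw hΦ.1, truncHom_apply_killLight_of_preserves w (w l) hpres] at h1
    exact h1
  · intro hB Φ Φ' hΦ
    have h1 := hB _ _ (isGradedAutPair_liftHom w (w l) hl hw hΦ) (fun i hi => killLight_liftHom_X w (w l) Φ hi)
    rw [liftHom_apply_killLight, ← killLight_apply_of_isGraded w (w l) hl hw hΦ.1] at h1
    exact h1

/-- The one-parameter family of shears `V₁ ↦ V₁ + k·W₂²` over `𝔽₅` (bookkeeping for the C446 witness; `shear446 = shearK 3`).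
[cite: AbramovichTemkinWlodarczyk2024, §5.1 (p. 1575)] -/
noncomputable def shearK (k : ZMod 5) : MvPolynomial (Fin 4) (ZMod 5) →ₐ[ZMod 5] MvPolynomial (Fin 4) (ZMod 5) :=
  aeval (Function.update X 0 (X 0 + C k * X 3 ^ 2))

/-- `shearK` on the sheared slot (bookkeeping). [cite: AbramovichTemkinWlodarczyk2024, §5.1 (p. 1575)] -/
theorem shearK_X_zero (k : ZMod 5) : shearK k (X 0) = X 0 + C k * X 3 ^ 2 := by
  rw [shearK, aeval_X, Function.update_self]

/-- `shearK` fixes the other slots (bookkeeping). [cite: AbramovichTemkinWlodarczyk2024, §5.1 (p. 1575)] -/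
theorem shearK_X_of_ne (k : ZMod 5) {i : Fin 4} (hi : i ≠ 0) : shearK k (X i) = X i := by
  rw [shearK, aeval_X, Function.update_of_ne hi]

/-- `shear446 = shearK 3` (bookkeeping). [cite: AbramovichTemkinWlodarczyk2024, §5.1 (p. 1575)] -/
theorem shear446_eq_shearK : shear446 = shearK 3 := by
  simp only [shear446, shearK, map_ofNat]

/-- `shearK k₁ ∘ shearK k₂ = id` when `k₁ + k₂ = 0` (bookkeeping: the shears form a one-parameter group).
[cite: AbramovichTemkinWlodarczyk2024, §5.1 (p. 1575)] -/
theorem shearK_shearK (k₁ k₂ : ZMod 5) (hk : k₁ + k₂ = 0) (g : MvPolynomial (Fin 4) (ZMod 5)) : shearK k₁ (shearK k₂ g) = g := by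
  have h3 : (3 : Fin 4) ≠ 0 := by decide
  have hcomp : (shearK k₁).comp (shearK k₂) = AlgHom.id (ZMod 5) _ := by
    refine algHom_ext fun i => ?_
    rw [AlgHom.comp_apply, AlgHom.id_apply]
    by_cases hi : i = 0
    · subst hi
      rw [shearK_X_zero, map_add, map_mul, map_pow, shearK_X_zero, shearK_X_of_ne _ h3, algHom_C, algebraMap_eq, add_assoc,
        ← add_mul, ← map_add, hk, map_zero, zero_mul, add_zero]
    · rw [shearK_X_of_ne _ hi, shearK_X_of_ne _ hi]
  exact DFunLike.congr_fun hcomp g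

/-- Each shear is GRADED for any weighting with `w(V₁) = 2·w(W₂)` (e.g. `(⅓,⅓,⅙,⅙)`) (bookkeeping). [cite: AbramovichTemkinWlodarczyk2024, §5.1 (p. 1575)] -/
theorem isGraded_shearK (w : Fin 4 → ℚ) (hw : w 0 = 2 * w 3) (k : ZMod 5) : IsGraded w (shearK k) := by
  intro i
  by_cases hi : i = 0
  · subst hi
    rw [shearK_X_zero]
    have h := ((isWeightedHomogeneous_X (ZMod 5) w 3).pow 2).C_mul k
    rw [two_nsmul, ← two_mul, ← hw] at h
    exact (isWeightedHomogeneous_X (ZMod 5) w 0).add h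
  · rw [shearK_X_of_ne _ hi]
    exact isWeightedHomogeneous_X (ZMod 5) w i

/-- The C446 shear and `V₁ ↦ V₁ + 2W₂²` form a graded automorphism pair (`3 + 2 = 0` in `𝔽₅`) (bookkeeping).
[cite: AbramovichTemkinWlodarczyk2024, §5.1 (p. 1575)] -/
theorem isGradedAutPair_shear446 (w : Fin 4 → ℚ) (hw : w 0 = 2 * w 3) : IsGradedAutPair w shear446 (shearK 2) := by
  rw [shear446_eq_shearK]
  exact ⟨isGraded_shearK w hw 3, isGraded_shearK w hw 2, shearK_shearK 3 2 (by decide), shearK_shearK 2 3 (by decide)⟩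

/-- **T70 (b)(i) in the quantified form** (derived here): for every weighting with `w(V₁) = 2·w(W₂)` the slot `W₂` of the C446 face is NOT
pinned over all graded automorphisms — `not_isPinnedIn_shear446_g446` fed to `SlotPinned`. [cite: AbramovichTemkinWlodarczyk2024, §5.1 (p. 1575)] -/
theorem not_slotPinned_g446 (w : Fin 4 → ℚ) (hw : w 0 = 2 * w 3) : ¬ SlotPinned w 3 g446 :=
  fun hP => not_isPinnedIn_shear446_g446 w (hP _ _ (isGradedAutPair_shear446 w hw))

end Automorphism

/-! ## Unpinnable slots: (P) is vacuous when no value-`μ` monomial can pin the slot (CARVER-NOTES eng1-g39 T71, FINDING F2) -/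

section Unpinnable

variable (w : ι → ℚ)

/-- Slot `l` is UNPINNABLE at the value `μ` for the weights `w` (engine 1, FINDING F2 / T71; ours): NO exponent vector of weight `μ`
contains `X_l` together with only variables of weight `≥ w_l`. [cite: AbramovichTemkinWlodarczyk2024, §5.1 (p. 1575)] -/
def Unpinnable (l : ι) (μ : ℚ) : Prop :=
  ∀ d : ι →₀ ℕ, d l ≠ 0 → IsHeavy (fun j => w l ≤ w j) d → Finsupp.weight w d ≠ μ

variable {w}

/-- **T71** (derived here): if slot `l` is unpinnable at `μ`, then `X_l` is pinned in NO weighted-homogeneous `g` of weight `μ`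
(a pinning monomial would be a heavy monomial of `g` of weight `μ` containing `X_l`). [cite: AbramovichTemkinWlodarczyk2024, §5.1 (p. 1575)] -/
theorem not_isPinnedIn_of_unpinnable {l : ι} {μ : ℚ} (hU : Unpinnable w l μ) {g : MvPolynomial ι S}
    (hg : IsWeightedHomogeneous w g μ) : ¬ IsPinnedIn w l g := by
  classical
  intro h
  rw [IsPinnedIn, mem_vars_iff_mem_support] at h
  obtain ⟨d, hd, hld⟩ := h
  rw [mem_support_iff, coeff_killLight] at hd
  by_cases hH : IsHeavy (fun j => w l ≤ w j) d
  · rw [if_pos hH] at hd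
    exact hU d (Finsupp.mem_support_iff.mp hld) hH (hg hd)
  · rw [if_neg hH] at hd
    exact hd rfl

/-- A graded endomorphism maps weighted-homogeneous polynomials to weighted-homogeneous polynomials of the same weight (derived here;
bookkeeping). [cite: AbramovichTemkinWlodarczyk2024, §5.1 (p. 1575)] -/
theorem IsGraded.isWeightedHomogeneous_apply {Φ : MvPolynomial ι S →ₐ[S] MvPolynomial ι S} (hΦ : IsGraded w Φ)
    {g : MvPolynomial ι S} {μ : ℚ} (hg : IsWeightedHomogeneous w g μ) : IsWeightedHomogeneous w (Φ g) μ := by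
  classical
  rw [g.as_sum, map_sum]
  refine IsWeightedHomogeneous.sum _ _ μ fun d hd => ?_
  rw [monomial_eq, map_mul, MvPolynomial.algHom_C, MvPolynomial.algebraMap_eq, Finsupp.prod, map_prod]
  have hwt : Finsupp.weight w d = μ := hg (mem_support_iff.mp hd)
  have hprod : IsWeightedHomogeneous w (∏ i ∈ d.support, Φ (X i ^ d i)) (∑ i ∈ d.support, d i • w i) :=
    IsWeightedHomogeneous.prod _ _ _ fun i _ => by rw [map_pow]; exact (hΦ i).pow (d i)
  rw [← hwt, Finsupp.weight_apply, Finsupp.sum]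
  exact hprod.C_mul _

/-- **T71, for every graded image** (derived here): if slot `l` is unpinnable at `μ`, then for EVERY graded endomorphism `Φ` and every
weighted-homogeneous `g` of weight `μ`, `X_l` is not pinned in `Φ g` — in particular no such `g` satisfies (P) at `l`
(`not_slotPinned_of_unpinnable`). [cite: AbramovichTemkinWlodarczyk2024, §5.1 (p. 1575)] -/
theorem not_isPinnedIn_apply_of_unpinnable {l : ι} {μ : ℚ} (hU : Unpinnable w l μ) {Φ : MvPolynomial ι S →ₐ[S] MvPolynomial ι S}
    (hΦ : IsGraded w Φ) {g : MvPolynomial ι S} (hg : IsWeightedHomogeneous w g μ) : ¬ IsPinnedIn w l (Φ g) :=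
  not_isPinnedIn_of_unpinnable hU (hΦ.isWeightedHomogeneous_apply hg)

variable (w) in
/-- The identity pair is a graded automorphism pair (bookkeeping). [cite: AbramovichTemkinWlodarczyk2024, §5.1 (p. 1575)] -/
theorem isGradedAutPair_id :
    IsGradedAutPair w (AlgHom.id S (MvPolynomial ι S)) (AlgHom.id S (MvPolynomial ι S)) :=
  ⟨fun i => isWeightedHomogeneous_X S w i, fun i => isWeightedHomogeneous_X S w i, fun _ => rfl, fun _ => rfl⟩

/-- **T71 — (P) is vacuous at an unpinnable slot** (derived here; CARVER-NOTES eng1-g39 T71, FINDING F2: "if a slot `l` of weight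
`w_l > η` admits NO value-1 monomial containing `l` whose other variables all weigh `≥ w_l`, then NO `g` on `(N, w)` satisfies (P) —
take `Π = id`"): `¬ SlotPinned w l g` for every weighted-homogeneous `g` of weight `μ`.  INSTRUMENT (bookkeeping for the toy model's
condition (P)), NOT a resolution theorem. [cite: AbramovichTemkinWlodarczyk2024, §5.1 (p. 1575)] -/
theorem not_slotPinned_of_unpinnable {l : ι} {μ : ℚ} (hU : Unpinnable w l μ) {g : MvPolynomial ι S}
    (hg : IsWeightedHomogeneous w g μ) : ¬ SlotPinned w l g := fun hP => by
  have h := hP _ _ (isGradedAutPair_id w)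
  rw [AlgHom.id_apply] at h
  exact not_isPinnedIn_of_unpinnable hU hg h

/-- **Congruence criterion for unpinnability** (derived here; the arithmetic behind T71's instances): scale the weights by `D`; if
`D·w_l = a` is coprime to a modulus `m`, every STRICTLY heavier weight scales to a multiple of `m`, `D·μ` is a multiple of `m`, and
`μ < m·w_l` (`0 < w_l`), then slot `l` is unpinnable at `μ`: in a heavy monomial of weight `μ` the total exponent `A ≥ 1` of the slots
of weight `w_l` satisfies `a·A ≡ 0 (mod m)`, so `m ∣ A`, so the weight is at least `m·w_l > μ`.
[cite: AbramovichTemkinWlodarczyk2024, §5.1 (p. 1575)] -/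
theorem unpinnable_of_congruence {l : ι} {μ : ℚ} (hl : 0 < w l) (D m a k₀ : ℕ) (k : ι → ℕ) (ha : (D : ℚ) * w l = a)
    (ham : Nat.Coprime a m) (hk : ∀ j, w l < w j → (D : ℚ) * w j = m * k j) (hμ : (D : ℚ) * μ = m * k₀)
    (hlt : μ < m * w l) : Unpinnable w l μ := by
  classical
  intro d hdl hH hwt
  have hsplit : ∀ f : ι → ℚ, ∑ j ∈ d.support, f j =
      ∑ j ∈ d.support.filter (fun j => w j = w l), f j + ∑ j ∈ d.support.filter (fun j => ¬ w j = w l), f j :=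
    fun f => (Finset.sum_filter_add_sum_filter_not d.support (fun j => w j = w l) f).symm
  have hUlt : ∀ j ∈ d.support.filter (fun j => ¬ w j = w l), w l < w j := by
    intro j hj
    rw [Finset.mem_filter] at hj
    exact lt_of_le_of_ne (hH j hj.1) (Ne.symm hj.2)
  set A := ∑ j ∈ d.support.filter (fun j => w j = w l), d j with hA
  set K := ∑ j ∈ d.support.filter (fun j => ¬ w j = w l), d j * k j with hK
  -- the weight equation, scaled by `D`, in `ℕ`
  have hnat : m * k₀ = m * K + a * A := by
    have h1 : (D : ℚ) * Finsupp.weight w d = m * K + a * A := by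
      rw [Finsupp.weight_apply, Finsupp.sum, Finset.mul_sum, hsplit, hA, hK, Nat.cast_sum, Nat.cast_sum, Finset.mul_sum,
        Finset.mul_sum, add_comm]
      congr 1
      · refine Finset.sum_congr rfl fun j hj => ?_
        rw [nsmul_eq_mul, mul_left_comm, hk j (hUlt j hj), Nat.cast_mul]
        ring
      · refine Finset.sum_congr rfl fun j hj => ?_
        rw [Finset.mem_filter] at hj
        rw [nsmul_eq_mul, hj.2, mul_left_comm, ha, mul_comm]
    rw [hwt, hμ] at h1
    exact_mod_cast h1
  -- `m ∣ A`
  have hmA : m ∣ A := by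
    have h2 : m ∣ m * K + a * A := hnat ▸ dvd_mul_right m k₀
    exact ham.symm.dvd_of_dvd_mul_left ((Nat.dvd_add_right (dvd_mul_right m K)).mp h2)
  -- `A ≥ 1`, hence `A ≥ m`
  have hlT : l ∈ d.support.filter (fun j => w j = w l) :=
    Finset.mem_filter.mpr ⟨Finsupp.mem_support_iff.mpr hdl, rfl⟩
  have hA1 : d l ≤ A := Finset.single_le_sum (f := fun j => d j) (fun _ _ => Nat.zero_le _) hlT
  have hmleA : m ≤ A := Nat.le_of_dvd (lt_of_lt_of_le (Nat.pos_of_ne_zero hdl) hA1) hmA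
  -- the weight is at least `A · w_l`
  have hge : (A : ℚ) * w l ≤ Finsupp.weight w d := by
    rw [Finsupp.weight_apply, Finsupp.sum, hsplit, hA, Nat.cast_sum, Finset.sum_mul]
    have hTeq : ∑ j ∈ d.support.filter (fun j => w j = w l), (d j : ℚ) * w l =
        ∑ j ∈ d.support.filter (fun j => w j = w l), d j • w j :=
      Finset.sum_congr rfl fun j hj => by
        rw [Finset.mem_filter] at hj
        rw [nsmul_eq_mul, hj.2]
    rw [hTeq]
    have hUnn : (0 : ℚ) ≤ ∑ j ∈ d.support.filter (fun j => ¬ w j = w l), d j • w j :=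
      Finset.sum_nonneg fun j hj => by
        rw [nsmul_eq_mul]
        exact mul_nonneg (Nat.cast_nonneg _) (hl.le.trans (hUlt j hj).le)
    linarith
  rw [hwt] at hge
  have hm : (m : ℚ) * w l ≤ A * w l := mul_le_mul_of_nonneg_right (by exact_mod_cast hmleA) hl.le
  linarith

/-- **T71, instance `(p; ½, ⅜, ¼)` — the `⅜` slot** (derived here): if `w_l = 3/8` and every strictly heavier slot weighs `1/2`
(any multiplicities), then `l` is unpinnable at the value `1`: `8 = 3A + 4B` forces `4 ∣ A ≥ 1`, i.e. `A ≥ 4`, weight `≥ 3/2`.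
[cite: AbramovichTemkinWlodarczyk2024, §5.1 (p. 1575)] -/
theorem unpinnable_three_eighths {l : ι} (hl : w l = 3 / 8) (hw : ∀ j, w l < w j → w j = 1 / 2) : Unpinnable w l 1 := by
  refine unpinnable_of_congruence (by rw [hl]; norm_num) 8 4 3 2 (fun _ => 1) (by rw [hl]; norm_num) (by decide)
    (fun j hj => by rw [hw j hj]; norm_num) (by norm_num) (by rw [hl]; norm_num)

/-- **T71, instances `(7; ½, ⅓, ⅙, 7/48)` and `(7; ½, ⅓, ⅙, ⅙, 7/48)` — the `7/48` slot** (derived here): if `w_l = 7/48` and every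
strictly heavier slot weighs `1/2`, `1/3` or `1/6` (any multiplicities), then `l` is unpinnable at the value `1`:
`48 = 7A + 8(3B + 2C + D)` forces `8 ∣ A ≥ 1`, i.e. `A ≥ 8`, weight `≥ 56/48`. [cite: AbramovichTemkinWlodarczyk2024, §5.1 (p. 1575)] -/
theorem unpinnable_seven_fortyEighths {l : ι} (hl : w l = 7 / 48)
    (hw : ∀ j, w l < w j → w j = 1 / 2 ∨ w j = 1 / 3 ∨ w j = 1 / 6) : Unpinnable w l 1 := by
  classical
  refine unpinnable_of_congruence (by rw [hl]; norm_num) 48 8 7 6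
    (fun j => if w j = 1 / 2 then 3 else if w j = 1 / 3 then 2 else 1) (by rw [hl]; norm_num) (by decide)
    (fun j hj => ?_) (by norm_num) (by rw [hl]; norm_num)
  rcases hw j hj with h | h | h
  · rw [h, if_pos rfl]; norm_num
  · rw [h, if_neg (by norm_num), if_pos rfl]; norm_num
  · rw [h, if_neg (by norm_num), if_neg (by norm_num)]; norm_num

/-- Hence (T71's conclusion for these systems; derived here): in a system with a `⅜` slot below only `½` slots, or a `7/48` slot below
only `½, ⅓, ⅙` slots, NO weighted-homogeneous `g` of weight `1` satisfies (P) at that slot — four of the g38 brute-force systems were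
vacuous. [cite: AbramovichTemkinWlodarczyk2024, §5.1 (p. 1575)] -/
theorem not_slotPinned_three_eighths {l : ι} (hl : w l = 3 / 8) (hw : ∀ j, w l < w j → w j = 1 / 2) {g : MvPolynomial ι S}
    (hg : IsWeightedHomogeneous w g 1) : ¬ SlotPinned w l g :=
  not_slotPinned_of_unpinnable (unpinnable_three_eighths hl hw) hg

/-- (the `7/48` case; derived here) [cite: AbramovichTemkinWlodarczyk2024, §5.1 (p. 1575)] -/
theorem not_slotPinned_seven_fortyEighths {l : ι} (hl : w l = 7 / 48)
    (hw : ∀ j, w l < w j → w j = 1 / 2 ∨ w j = 1 / 3 ∨ w j = 1 / 6) {g : MvPolynomial ι S}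
    (hg : IsWeightedHomogeneous w g 1) : ¬ SlotPinned w l g :=
  not_slotPinned_of_unpinnable (unpinnable_seven_fortyEighths hl hw) hg

end Unpinnable


/-! ## T70 (b)(ii): every BLOCK-DIAGONAL graded automorphism keeps `W₂` present in `g446` (a proof, not an enumeration) -/

section BlockDiagonal

/-- The BLOCK-DIAGONAL substitution `V ↦ A·V`, `W ↦ B·W` over `𝔽₅` with `A = (a b; c d)`, `B = (e f; g h)` acting on `(V₁,V₂) = (X₀,X₁)`,
`(W₁,W₂) = (X₂,X₃)` (bookkeeping for T70 (b)(ii)). [cite: AbramovichTemkinWlodarczyk2024, §5.1 (p. 1575)] -/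
noncomputable def blockVec (a b c d e f g h : ZMod 5) : Fin 4 → MvPolynomial (Fin 4) (ZMod 5) :=
  ![C a * X 0 + C b * X 1, C c * X 0 + C d * X 1, C e * X 2 + C f * X 3, C g * X 2 + C h * X 3]

/-- Evaluating `g446∘Π` at a point (bookkeeping). [cite: AbramovichTemkinWlodarczyk2024, §5.1 (p. 1575)] -/
theorem eval_aeval_g446 (π : Fin 4 → MvPolynomial (Fin 4) (ZMod 5)) (ε : Fin 4 → ZMod 5) :
    eval ε (aeval π g446) = eval ε (π 0) * eval ε (π 1) ^ 2 + 2 * eval ε (π 1) ^ 2 * (eval ε (π 2) ^ 2 + eval ε (π 3) ^ 2)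
      + 2 * eval ε (π 1) * eval ε (π 2) ^ 4 + 2 * eval ε (π 2) ^ 6 := by
  simp only [g446, map_add, map_mul, map_pow, aeval_X, map_ofNat]

/-- The point values of the block-diagonal substitution at `(x, y, 0, t)` (bookkeeping). [cite: AbramovichTemkinWlodarczyk2024, §5.1 (p. 1575)] -/
theorem eval_blockVec (a b c d e f g h x y t : ZMod 5) :
    eval ![x, y, 0, t] (blockVec a b c d e f g h 0) = a * x + b * y ∧ eval ![x, y, 0, t] (blockVec a b c d e f g h 1) = c * x + d * y ∧
      eval ![x, y, 0, t] (blockVec a b c d e f g h 2) = f * t ∧ eval ![x, y, 0, t] (blockVec a b c d e f g h 3) = h * t := by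
  simp [blockVec]

/-- If `W₂ = X₃` does not occur in `F`, the value of `F` at `(x, y, 0, t)` does not depend on `t` (bookkeeping). [cite: Lang2002, Ch. IV §1] -/
theorem eval_eq_eval_of_notMem_vars {F : MvPolynomial (Fin 4) (ZMod 5)} (hF : (3 : Fin 4) ∉ F.vars) (x y t : ZMod 5) :
    eval ![x, y, 0, t] F = eval ![x, y, 0, 0] F := by
  refine hom_congr_vars (by ext r; simp) (fun i hi _ => ?_) rfl
  fin_cases i <;> simp_all

/-- **T70 (b)(ii)** (engine 1, b11check38 / C446: "`W₂` occurs in `g∘(A,B)` for all 900 block-diagonal classes `(A,B)`"; derived here by PROOF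
for every invertible block-diagonal pair over `𝔽₅`, no enumeration): `W₂ ∈ vars (g446∘(A ⊕ B))`.  Proof: otherwise the value at `(x,y,0,t)`
is independent of `t`; comparing `t = 1` with `t = 0` gives `2(cx+dy)²(f²+h²) + 2(cx+dy)f⁴ + 2f⁶ = 0` for all `x, y`; `x = y = 0` forces
`f = 0`, a point with `cx + dy = 1` (it exists as `(c,d) ≠ 0`) forces `h = 0`, contradicting `det B ≠ 0`.  Together with `not_slotPinned_g446`:
the decoupled block-diagonal criterion holds for `g446` while (P) fails — REMARK S (4)'s point that the criterion is valid only in shear-normal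
form. [cite: AbramovichTemkinWlodarczyk2024, §5.1 (p. 1575)] -/
theorem mem_vars_blockDiag_g446 (a b c d e f g h : ZMod 5) (hA : a * d - b * c ≠ 0) (hB : e * h - f * g ≠ 0) :
    (3 : Fin 4) ∈ (aeval (blockVec a b c d e f g h) g446).vars := by
  have h2 : (2 : ZMod 5) ≠ 0 := by decide
  have hp : Fact (Nat.Prime 5) := ⟨Nat.prime_five⟩
  by_contra h3
  have key : ∀ x y : ZMod 5, 2 * (c * x + d * y) ^ 2 * (f ^ 2 + h ^ 2) + 2 * (c * x + d * y) * f ^ 4 + 2 * f ^ 6 = 0 := by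
    intro x y
    have E := eval_eq_eval_of_notMem_vars h3 x y 1
    obtain ⟨h0, h1, h2', h3'⟩ := eval_blockVec a b c d e f g h x y 1
    obtain ⟨k0, k1, k2, k3⟩ := eval_blockVec a b c d e f g h x y 0
    rw [eval_aeval_g446, eval_aeval_g446, h0, h1, h2', h3', k0, k1, k2, k3] at E
    linear_combination E
  have hf : f = 0 := by
    have h00 := key 0 0
    simp only [mul_zero, add_zero, zero_pow two_ne_zero, zero_mul, zero_add] at h00
    have : f ^ 6 = 0 := by
      rcases mul_eq_zero.mp h00 with h' | h'
      · exact absurd h' h2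
      · exact h'
    exact pow_eq_zero_iff (by norm_num) |>.mp this
  have hh : h = 0 := by
    have aux : ∀ x y : ZMod 5, c * x + d * y = 1 → h = 0 := by
      intro x y hxy
      have k := key x y
      rw [hxy, hf] at k
      simp only [one_pow, zero_pow two_ne_zero, zero_add, zero_pow (by norm_num : (4 : ℕ) ≠ 0), zero_pow (by norm_num : (6 : ℕ) ≠ 0),
        mul_zero, add_zero] at k
      have : h ^ 2 = 0 := by
        rcases mul_eq_zero.mp k with h' | h'
        · exact absurd h' h2
        · exact h'
      exact pow_eq_zero_iff two_ne_zero |>.mp this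
    by_cases hc : c = 0
    · have hd : d ≠ 0 := by
        rintro rfl
        exact hA (by rw [hc]; ring)
      exact aux 0 d⁻¹ (by rw [hc, zero_mul, zero_add, mul_inv_cancel₀ hd])
    · exact aux c⁻¹ 0 (by rw [mul_zero, add_zero, mul_inv_cancel₀ hc])
  exact hB (by rw [hf, hh]; ring)

end BlockDiagonal

end Truncation

end Literature.AlgebraicGeometry.Resolution.WeightedBlowup
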